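import Literature.Probability.Percolation.PortLink
import HarnessLib

/-!
# The side chain for a family of tile domains (several accessible components)

Topic `Probability/Percolation`.  Support file (definitions and proofs, no named fact) for step (C)
of the proof of Schramm–Smirnov's Prop. 4.1 (Ann. Probab. 39 (2011), §4).  In the printed proof the
fresh region `M'` ("the component of `[Q₀] ∖ β'` containing `α`, and the bays") need not be
connected: the cut `α ∩ [Q₀]` has finitely many pieces once the junction discs are removed, and the
graph `G*` simply records connectivity inside whichever piece.  The lattice structure theorem of the
tree is organised around ONE tile domain `𝒯` (one accessible component, one traced boundary loop,
`PortChain.mem_z2QuadConfig_iff_sideChain`); here it is extended to a finite FAMILY of tile domains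
`𝒯 i` sharing the hub vertices, the examined edges and the window, one for each accessibility
class of fresh edges (`TileFamily`).

The point is purely combinatorial: two accessible edges sharing a NON-hub vertex lie in the same
class (`TileFamily.mem_acc_of_shared`, from the accessibility closure of each `𝒯 i`), so an open
accessible walk between hub vertices splits at its hub vertices into docking pieces each of which
runs inside ONE domain (`TileFamily.exists_dockChain_of_accAdj`).  Hence the quad is crossed iff
`∂₀Q` is joined to `∂₂Q` in the graph whose vertices are the sides of ALL the traced loops, with
the revealed relation `Gst` between any two sides (possibly of different loops) and the fresh
relation `Bit` between two sides of the SAME loop (`TileFamily.mem_z2QuadConfig_iff_sideChain`).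

## References

* O. Schramm, S. Smirnov, *On the scaling limits of planar percolation*, Ann. Probab. 39 (2011)
  1768–1814, arXiv:1101.5820, §4, proof of Prop. 4.1 ("Describing the crossing structure by a
  finite graph"). [SchrammSmirnov2011]
-/

noncomputable section

open Set Relation
open Literature.Probability.LatticeModels
open scoped Classical

namespace Literature.Probability.Percolation

namespace CellComplex

open QuadCrossing TileData

/-! ### Families of tile domains sharing the explored data -/

/-- **A family of tile domains** sharing the hub vertices `O`, the examined open and closed edges and
the window: one `TileData` per accessibility class of fresh edges.
[cite: SchrammSmirnov2011, §4, proof of Prop. 4.1 (M' and the graph G*)] -/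
structure TileFamily (ι : Type*) where
  /-- the tile domains -/
  𝒯 : ι → TileData
  /-- the common hub vertices -/
  O : Set (Site 2)
  /-- the common examined open edges -/
  hubE : Set (Sym2 (Site 2))
  /-- the common examined closed edges -/
  clE : Set (Sym2 (Site 2))
  /-- the common window -/
  Wv : Set (Site 2)
  O_eq : ∀ i, (𝒯 i).O = O
  hubE_eq : ∀ i, (𝒯 i).hubE = hubE
  clE_eq : ∀ i, (𝒯 i).clE = clE
  Wv_eq : ∀ i, (𝒯 i).Wv = Wv

namespace TileFamily

variable {ι : Type*} (𝔉 : TileFamily ι)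

/-- **All accessible edges** of the family. [folklore] -/
def accU : Set (Sym2 (Site 2)) := ⋃ i, (↑(𝔉.𝒯 i).acc : Set (Sym2 (Site 2)))

/-- Membership in the accessible edges of the family. [folklore] -/
theorem mem_accU_iff {e : Sym2 (Site 2)} : e ∈ 𝔉.accU ↔ ∃ i, e ∈ (𝔉.𝒯 i).acc := by
  simp [accU]

/-- An accessible edge of a member is accessible for the family. [folklore] -/
theorem mem_accU_of_mem {i : ι} {e : Sym2 (Site 2)} (he : e ∈ (𝔉.𝒯 i).acc) : e ∈ 𝔉.accU :=
  𝔉.mem_accU_iff.2 ⟨i, he⟩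

variable {𝔉}

/-- **Class constancy through non-hub vertices**: an accessible edge of `𝒯 j` sharing a non-hub
vertex with an accessible edge of `𝒯 i` is accessible for `𝒯 i` (accessibility closure of `𝒯 i`;
the edge is a fresh window edge). [folklore] -/
theorem mem_acc_of_shared {i j : ι} {e e' : Sym2 (Site 2)} (he : e ∈ (𝔉.𝒯 i).acc) (he' : e' ∈ (𝔉.𝒯 j).acc)
    {w : Site 2} (hw : w ∈ e) (hw' : w ∈ e') (hwO : w ∉ 𝔉.O) : e' ∈ (𝔉.𝒯 i).acc := by
  have hwO' : w ∉ (𝔉.𝒯 i).O := by rw [𝔉.O_eq]; exact hwO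
  have hwin : ∀ v ∈ e', v ∈ (𝔉.𝒯 i).Wv := fun v hv => by
    rw [𝔉.Wv_eq, ← 𝔉.Wv_eq j]; exact (𝔉.𝒯 j).acc_window _ he' v hv
  rcases (𝔉.𝒯 i).closure _ he w hw hwO' _ ((𝔉.𝒯 j).acc_edge _ he') hw' hwin with h | h | h
  · rw [𝔉.hubE_eq, ← 𝔉.hubE_eq j] at h
    exact absurd h ((𝔉.𝒯 j).acc_not_hub _ he')
  · rw [𝔉.clE_eq, ← 𝔉.clE_eq j] at h
    exact absurd h ((𝔉.𝒯 j).acc_not_cl _ he')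
  · exact h

/-- An accessible step of the family at a non-hub vertex after an accessible step of `𝒯 i` is an
accessible step of `𝒯 i`. [folklore] -/
theorem accAdj_of_accAdj_accU {η : BondConfig (Site 2)} {i : ι} {u v w : Site 2}
    (huv : AccAdj η (↑(𝔉.𝒯 i).acc) u v) (hvw : AccAdj η 𝔉.accU v w) (hvO : v ∉ 𝔉.O) :
    AccAdj η (↑(𝔉.𝒯 i).acc) v w := by
  obtain ⟨hadj, hη, hacc⟩ := hvw
  obtain ⟨j, hj⟩ := 𝔉.mem_accU_iff.1 hacc
  exact ⟨hadj, hη, mem_acc_of_shared huv.2.2 hj (Sym2.mem_mk_right u v) (Sym2.mem_mk_left v w) hvO⟩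

/-! ### Splitting an accessible open walk of the family at its hub vertices -/

/-- **Splitting at hub vertices, family version**: an open walk through accessible edges of the
family between hub vertices is a chain of docking pieces, each inside ONE tile domain.
[cite: SchrammSmirnov2011, §4, proof of Prop. 4.1 (the edges of G*)] -/
theorem exists_dockChain_of_accAdj {η : BondConfig (Site 2)} {a b : Site 2} (haO : a ∈ 𝔉.O) (hbO : b ∈ 𝔉.O)
    (h : ReflTransGen (AccAdj η 𝔉.accU) a b) :
    ReflTransGen (fun x y => x ∈ 𝔉.O ∧ y ∈ 𝔉.O ∧ ∃ i, (𝔉.𝒯 i).DockPiece η x y) a b := by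
  obtain ⟨l, hchain, hlast⟩ := List.exists_isChain_cons_of_relationReflTransGen h
  suffices H : ∀ (n : ℕ) (a : Site 2) (l : List (Site 2)), l.length = n → a ∈ 𝔉.O →
      List.IsChain (AccAdj η 𝔉.accU) (a :: l) → (a :: l).getLast (List.cons_ne_nil a l) ∈ 𝔉.O →
      ReflTransGen (fun x y => x ∈ 𝔉.O ∧ y ∈ 𝔉.O ∧ ∃ i, (𝔉.𝒯 i).DockPiece η x y) a
        ((a :: l).getLast (List.cons_ne_nil a l)) by
    have := H l.length a l rfl haO hchain (hlast.symm ▸ hbO)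
    rwa [hlast] at this
  intro n
  induction n using Nat.strong_induction_on with
  | _ n ih =>
    intro a l hl haO hchain hbO
    rcases l with _ | ⟨v, l⟩
    · simpa using ReflTransGen.refl
    · have hn : n = l.length + 1 := by simpa using hl.symm
      have hav : AccAdj η 𝔉.accU a v := hchain.rel
      -- the class of the first edge
      obtain ⟨i, hi⟩ := 𝔉.mem_accU_iff.1 hav.2.2
      have hav' : AccAdj η (↑(𝔉.𝒯 i).acc) a v := ⟨hav.1, hav.2.1, hi⟩
      have haO' : a ∈ (𝔉.𝒯 i).O := by rw [𝔉.O_eq]; exact haO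
      obtain ⟨k, rfl, hσa, hβa, hηa⟩ := dock_of_accAdj haO' hav'
      have hvO : a + cornerUnit k ∉ 𝔉.O := by
        obtain ⟨w, hw, hwO⟩ := (𝔉.𝒯 i).acc_nonO _ (hav'.2.2 : dartEdge a k ∈ (𝔉.𝒯 i).acc)
        rw [𝔉.O_eq] at hwO
        rcases mem_dartEdge_iff.1 hw with rfl | rfl
        · exact absurd haO hwO
        · exact hwO
      have hchain' : List.IsChain (AccAdj η 𝔉.accU) ((a + cornerUnit k) :: l) := hchain.tail
      -- scan inside the class `i`: from a non-hub vertex `u` reached from the dock by open steps of `𝒯 i`,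
      -- the last step into `u` being an accessible step of `𝒯 i`
      have scan : ∀ (l' : List (Site 2)) (p u : Site 2), l'.length ≤ l.length → u ∉ 𝔉.O →
          AccAdj η (↑(𝔉.𝒯 i).acc) p u →
          ReflTransGen (OpenStep (𝔉.𝒯 i).U η) (a + cornerUnit k) u →
          List.IsChain (AccAdj η 𝔉.accU) (u :: l') → (u :: l').getLast (List.cons_ne_nil u l') ∈ 𝔉.O →
          ReflTransGen (fun x y => x ∈ 𝔉.O ∧ y ∈ 𝔉.O ∧ ∃ i, (𝔉.𝒯 i).DockPiece η x y) a
            ((u :: l').getLast (List.cons_ne_nil u l')) := by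
        intro l'
        induction l' with
        | nil =>
          intro p u _ huO _ _ _ hlastO
          exact absurd (by simpa using hlastO) huO
        | cons w l' ihl =>
          intro p u hlen huO hpu hpath hch hlastO
          have huw : AccAdj η (↑(𝔉.𝒯 i).acc) u w := accAdj_of_accAdj_accU hpu hch.rel huO
          by_cases hwO : w ∈ 𝔉.O
          · -- the piece ends at the hub vertex `w`
            have hwO' : w ∈ (𝔉.𝒯 i).O := by rw [𝔉.O_eq]; exact hwO
            obtain ⟨k', rfl, hσw, hβw, hηw⟩ := dock_of_accAdj hwO' huw.symm
            have hpiece : (𝔉.𝒯 i).DockPiece η a w := ⟨k, k', hσa, hβa, hηa, hσw, hβw, hηw, hpath⟩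
            have hrest := ih l'.length (by simp at hlen ⊢; omega) w l' rfl hwO hch.tail (by simpa using hlastO)
            have hfirst : ReflTransGen (fun x y => x ∈ 𝔉.O ∧ y ∈ 𝔉.O ∧ ∃ i, (𝔉.𝒯 i).DockPiece η x y) a w :=
              ReflTransGen.single ⟨haO, hwO, i, hpiece⟩
            simpa [List.getLast_cons_cons] using hfirst.trans hrest
          · have huO' : u ∉ (𝔉.𝒯 i).O := by rw [𝔉.O_eq]; exact huO
            have hwO' : w ∉ (𝔉.𝒯 i).O := by rw [𝔉.O_eq]; exact hwO
            have hstep : OpenStep (𝔉.𝒯 i).U η u w := openStep_of_accAdj huO' hwO' huw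
            have := ihl u w (by simp at hlen ⊢; omega) hwO huw (hpath.tail hstep) hch.tail (by simpa using hlastO)
            simpa [List.getLast_cons_cons] using this
      have := scan l a (a + cornerUnit k) le_rfl hvO hav' ReflTransGen.refl hchain' (by simpa using hbO)
      simpa [List.getLast_cons_cons] using this

/-! ### The side-level relations of the family -/

section SideChain

variable {D : Set ℂ} {δ : ℝ}

variable (𝔉) in
/-- **Revealed connection** (family version): a preconnected set of drawn open edges that are not
accessible for any member, inside the carrier. [cite: SchrammSmirnov2011, §4, proof of Prop. 4.1 (the graph G)] -/
def RevPt (Q : Quad D) (δ : ℝ) (η : BondConfig (Site 2)) (p q : ℂ) : Prop :=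
  ∃ S ⊆ openEdgeUnion δ (η \ 𝔉.accU) ∩ Q.carrier, IsPreconnected S ∧ p ∈ S ∧ q ∈ S

variable {Q : Quad D} {η : BondConfig (Site 2)}

/-- `RevPt` is reflexive at drawn revealed points of the carrier. [folklore] -/
theorem RevPt.of_mem {p : ℂ} (hp : p ∈ openEdgeUnion δ (η \ 𝔉.accU)) (hpQ : p ∈ Q.carrier) : 𝔉.RevPt Q δ η p p :=
  ⟨{p}, by simpa using And.intro hp hpQ, isPreconnected_singleton, rfl, rfl⟩

/-- `RevPt` is transitive. [folklore] -/
theorem RevPt.trans {p q r : ℂ} (h : 𝔉.RevPt Q δ η p q) (h' : 𝔉.RevPt Q δ η q r) : 𝔉.RevPt Q δ η p r := by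
  obtain ⟨S, hS, hSc, hp, hq⟩ := h
  obtain ⟨S', hS', hSc', hq', hr⟩ := h'
  exact ⟨S ∪ S', union_subset hS hS', hSc.union q hq hq' hSc', Or.inl hp, Or.inr hr⟩

/-- The right endpoint of `RevPt` is a drawn revealed point of the carrier. [folklore] -/
theorem RevPt.mem_right {p q : ℂ} (h : 𝔉.RevPt Q δ η p q) : q ∈ openEdgeUnion δ (η \ 𝔉.accU) ∧ q ∈ Q.carrier := by
  obtain ⟨S, hS, -, -, hq⟩ := h; exact hS hq

/-- The sides of all the traced loops: a member index and a side index. [folklore] -/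
abbrev Side (ι : Type*) := ι × ℕ

variable (𝔉) in
/-- **Revealed step between two sides of the family** (possibly of different loops): both are hub
contacts and attached hub vertices are joined by a revealed connection.
[cite: SchrammSmirnov2011, §4, proof of Prop. 4.1 (the graph G)] -/
def Gst (d₀ : ι → Site 2 × Fin 4) (Q : Quad D) (δ : ℝ) (η : BondConfig (Site 2)) (s t : Side ι) : Prop :=
  (𝔉.𝒯 s.1).hubContact (d₀ s.1) s.2 ∧ (𝔉.𝒯 t.1).hubContact (d₀ t.1) t.2 ∧
    ∃ v ∈ (𝔉.𝒯 s.1).att ((𝔉.𝒯 s.1).outCell (d₀ s.1) s.2),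
      ∃ v' ∈ (𝔉.𝒯 t.1).att ((𝔉.𝒯 t.1).outCell (d₀ t.1) t.2), 𝔉.RevPt Q δ η (meshPoint δ v) (meshPoint δ v')

variable (𝔉) in
/-- **Docking bit between two sides of the SAME loop.** [cite: SchrammSmirnov2011, §4, proof of Prop. 4.1 (the graph G*)] -/
def Bit (d₀ : ι → Site 2 × Fin 4) (η : BondConfig (Site 2)) (s t : Side ι) : Prop :=
  s.1 = t.1 ∧ (𝔉.𝒯 s.1).Bit (d₀ s.1) η s.2 t.2

variable (𝔉) in
/-- Start of the chain: a revealed connection from `z₀` to a hub vertex attached to the side. [folklore] -/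
def StartAt (d₀ : ι → Site 2 × Fin 4) (Q : Quad D) (δ : ℝ) (η : BondConfig (Site 2)) (z₀ : ℂ) (s : Side ι) : Prop :=
  (𝔉.𝒯 s.1).hubContact (d₀ s.1) s.2 ∧
    ∃ v ∈ (𝔉.𝒯 s.1).att ((𝔉.𝒯 s.1).outCell (d₀ s.1) s.2), 𝔉.RevPt Q δ η z₀ (meshPoint δ v)

variable (𝔉) in
/-- End of the chain: a revealed connection from a hub vertex attached to the side to `z₂`. [folklore] -/
def EndAt (d₀ : ι → Site 2 × Fin 4) (Q : Quad D) (δ : ℝ) (η : BondConfig (Site 2)) (s : Side ι) (z₂ : ℂ) : Prop :=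
  (𝔉.𝒯 s.1).hubContact (d₀ s.1) s.2 ∧
    ∃ v ∈ (𝔉.𝒯 s.1).att ((𝔉.𝒯 s.1).outCell (d₀ s.1) s.2), 𝔉.RevPt Q δ η (meshPoint δ v) z₂

/-! ### Auxiliary facts -/

/-- A window hub vertex carries an examined open edge, so its mesh point lies on a drawn revealed open
edge (family version). [folklore] -/
theorem meshPoint_mem_openEdgeUnion_of_hub [Nonempty ι] (hhubη : ∀ e ∈ 𝔉.hubE, e ∈ η) {x : Site 2}
    (hxO : x ∈ 𝔉.O) (hxW : x ∈ 𝔉.Wv) : meshPoint δ x ∈ openEdgeUnion δ (η \ 𝔉.accU) := by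
  obtain ⟨i⟩ := ‹Nonempty ι›
  have hxO' : x ∈ (𝔉.𝒯 i).O := by rw [𝔉.O_eq]; exact hxO
  obtain ⟨u, huW, hpath⟩ := (𝔉.𝒯 i).esc_O x hxO'
  obtain ⟨y, hxy⟩ : ∃ y, s(x, y) ∈ (𝔉.𝒯 i).hubE := by
    induction hpath using ReflTransGen.head_induction_on with
    | refl => rw [𝔉.Wv_eq] at huW; exact absurd hxW huW
    | head h _ _ => exact ⟨_, h⟩
  have hadj : (zdGraph 2).Adj x y := (SimpleGraph.mem_edgeSet (G := zdGraph 2)).1 ((𝔉.𝒯 i).hub_edge _ hxy)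
  rw [mem_openEdgeUnion_iff]
  refine ⟨x, y, hadj, ⟨hhubη _ (by rw [← 𝔉.hubE_eq i]; exact hxy), fun h => ?_⟩, left_mem_segment _ _ _⟩
  obtain ⟨j, hj⟩ := 𝔉.mem_accU_iff.1 h
  exact (𝔉.𝒯 j).acc_not_hub _ hj (by rw [𝔉.hubE_eq, ← 𝔉.hubE_eq i]; exact hxy)

/-- A docking vertex of `𝒯 i` is a hub vertex of the window whose mesh point lies in the carrier. [folklore] -/
theorem dock_facts (hacc : ∀ u v : Site 2, AccAdj η 𝔉.accU u v → segment ℝ (meshPoint δ u) (meshPoint δ v) ⊆ Q.carrier)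
    {i : ι} {x : Site 2} {k : Fin 4} (hσ : σc x ∉ (𝔉.𝒯 i).U) (hβ : βc x k ∈ (𝔉.𝒯 i).U) (hη : dartEdge x k ∈ η) :
    x ∈ 𝔉.O ∧ x ∈ 𝔉.Wv ∧ meshPoint δ x ∈ Q.carrier ∧ AccAdj η (↑(𝔉.𝒯 i).acc) x (x + cornerUnit k) := by
  have hacc' : dartEdge x k ∈ (𝔉.𝒯 i).acc := (βc_mem_U_iff (𝔉.𝒯 i)).1 hβ
  have hA : AccAdj η (↑(𝔉.𝒯 i).acc) x (x + cornerUnit k) := ⟨adj_iff_exists_cornerUnit.2 ⟨k, rfl⟩, hη, hacc'⟩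
  have hA' : AccAdj η 𝔉.accU x (x + cornerUnit k) := ⟨hA.1, hA.2.1, 𝔉.mem_accU_of_mem hacc'⟩
  refine ⟨?_, ?_, hacc _ _ hA' (left_mem_segment _ _ _), hA⟩
  · rw [← 𝔉.O_eq i]; exact mem_O_of_dock hσ hβ
  · rw [← 𝔉.Wv_eq i]; exact (𝔉.𝒯 i).acc_window _ hacc' x (mem_dartEdge_iff.2 (Or.inl rfl))

/-- **Bridging inside a hub cell** (family version of `TileData.revPt_of_att`). [folklore] -/
theorem revPt_of_att (hhubη : ∀ e ∈ 𝔉.hubE, e ∈ η)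
    (hhubQ : ∀ (y : Site 2) (m : Fin 4), dartEdge y m ∈ 𝔉.hubE →
      segment ℝ (meshPoint δ y) (meshPoint δ (y + cornerUnit m)) ⊆ Q.carrier)
    {i : ι} {c v v' : Site 2} (hc : (𝔉.𝒯 i).IsHubCell c) (hv : v ∈ (𝔉.𝒯 i).att c) (hv' : v' ∈ (𝔉.𝒯 i).att c)
    (hvpt : meshPoint δ v ∈ openEdgeUnion δ (η \ 𝔉.accU) ∧ meshPoint δ v ∈ Q.carrier) :
    𝔉.RevPt Q δ η (meshPoint δ v) (meshPoint δ v') := by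
  rcases hc with ⟨x, hxO, rfl⟩ | ⟨y, m, hhub, rfl⟩
  · obtain ⟨rfl, -⟩ := mem_att_σc_iff.1 hv
    obtain ⟨rfl, -⟩ := mem_att_σc_iff.1 hv'
    exact RevPt.of_mem hvpt.1 hvpt.2
  · have hhub' : dartEdge y m ∈ 𝔉.hubE := by rw [← 𝔉.hubE_eq i]; exact hhub
    have hends : ∀ w ∈ (𝔉.𝒯 i).att (βc y m), w ∈ dartEdge y m := by
      rintro w ⟨-, h | ⟨m', h⟩⟩
      · exact absurd h.symm (σc_ne_βc w y m)
      · have : dartEdge y m = dartEdge w m' :=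
          bcell_injOn (dartEdge_mem_edgeSet _ _) (dartEdge_mem_edgeSet _ _) (by rw [bcell_dartEdge, bcell_dartEdge, h])
        rw [this]; exact mem_dartEdge_iff.2 (Or.inl rfl)
    set S : Set ℂ := segment ℝ (meshPoint δ y) (meshPoint δ (y + cornerUnit m)) with hS
    have hSsub : S ⊆ openEdgeUnion δ (η \ 𝔉.accU) ∩ Q.carrier := by
      refine subset_inter (fun z hz => ?_) (hhubQ y m hhub')
      rw [mem_openEdgeUnion_iff]
      refine ⟨y, y + cornerUnit m, adj_iff_exists_cornerUnit.2 ⟨m, rfl⟩, ⟨hhubη _ hhub', fun h => ?_⟩, hz⟩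
      obtain ⟨j, hj⟩ := 𝔉.mem_accU_iff.1 h
      exact (𝔉.𝒯 j).acc_not_hub _ hj (by rw [𝔉.hubE_eq]; exact hhub')
    have hmemS : ∀ w ∈ dartEdge y m, meshPoint δ w ∈ S := by
      intro w hw
      rcases mem_dartEdge_iff.1 hw with rfl | rfl
      · exact left_mem_segment _ _ _
      · exact right_mem_segment _ _ _
    exact ⟨S, hSsub, (convex_segment _ _).isPreconnected, hmemS v (hends v hv), hmemS v' (hends v' hv')⟩

/-! ### The theorem -/

variable {d₀ : ι → Site 2 × Fin 4}
  (h₀ : ∀ i, IsBd (𝔉.𝒯 i).U (d₀ i)) (hδ : 0 < δ)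
  (hcons : ∀ e ∈ 𝔉.clE, e ∉ η)
  (hX : ∀ e ∈ (zdGraph 2).edgeSet, (∃ v ∈ e, v ∈ 𝔉.Wv) → (∃ u ∈ e, u ∉ 𝔉.Wv) → e ∈ 𝔉.hubE ∨ e ∈ 𝔉.clE)
  (hhubη : ∀ e ∈ 𝔉.hubE, e ∈ η)
  (hhubQ : ∀ (y : Site 2) (m : Fin 4), dartEdge y m ∈ 𝔉.hubE →
    segment ℝ (meshPoint δ y) (meshPoint δ (y + cornerUnit m)) ⊆ Q.carrier)
  (h0 : Disjoint (Q.side 0) (openEdgeUnion δ (η ∩ 𝔉.accU))) (h2 : Disjoint (Q.side 2) (openEdgeUnion δ (η ∩ 𝔉.accU)))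
  (hacc : ∀ u v : Site 2, AccAdj η 𝔉.accU u v → segment ℝ (meshPoint δ u) (meshPoint δ v) ⊆ Q.carrier)
include h₀ hδ hcons hX hhubη hhubQ h0 h2 hacc

omit h₀ hδ hcons hX hhubη hhubQ h2 hacc in
/-- A point of `∂₀Q` on a drawn open edge lies on a drawn revealed open edge. [folklore] -/
theorem mem_openEdgeUnion_sdiff_of_side0 {z : ℂ} (hz : z ∈ Q.side 0) (hzO : z ∈ openEdgeUnion δ η) :
    z ∈ openEdgeUnion δ (η \ 𝔉.accU) := by
  rw [mem_openEdgeUnion_iff] at hzO ⊢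
  obtain ⟨x, y, hxy, hη, hz'⟩ := hzO
  refine ⟨x, y, hxy, ⟨hη, fun hacc' => ?_⟩, hz'⟩
  exact Set.disjoint_left.1 h0 hz (mem_openEdgeUnion_iff.2 ⟨x, y, hxy, ⟨hη, hacc'⟩, hz'⟩)

omit h₀ hδ hhubη hhubQ h0 h2 hacc in
/-- **Junctions are hub vertices** (family version). [folklore] -/
theorem junction_mem_O :
    ∀ u v w : Site 2, (zdGraph 2).Adj u v → (zdGraph 2).Adj v w → s(u, v) ∈ η → s(v, w) ∈ η →
      s(u, v) ∈ 𝔉.accU → s(v, w) ∉ 𝔉.accU → v ∈ 𝔉.O := by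
  intro u v w huv hvw huvη hvwη huv' hvw'
  obtain ⟨i, hi⟩ := 𝔉.mem_accU_iff.1 huv'
  have hcons' : ∀ e ∈ (𝔉.𝒯 i).clE, e ∉ η := fun e he => hcons e (by rw [← 𝔉.clE_eq i]; exact he)
  have hX' : ∀ e ∈ (zdGraph 2).edgeSet, (∃ v ∈ e, v ∈ (𝔉.𝒯 i).Wv) → (∃ u ∈ e, u ∉ (𝔉.𝒯 i).Wv) →
      e ∈ (𝔉.𝒯 i).hubE ∨ e ∈ (𝔉.𝒯 i).clE := by
    rw [𝔉.Wv_eq, 𝔉.hubE_eq, 𝔉.clE_eq]; exact hX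
  have := TileData.junction_mem_O (𝒯 := 𝔉.𝒯 i) hcons' hX' u v w huv hvw huvη hvwη hi
    (fun h => hvw' (𝔉.mem_accU_of_mem h))
  rwa [𝔉.O_eq] at this

omit hcons hX h0 h2 in
/-- **(⇐) Soundness of the side chain of the family.** [cite: SchrammSmirnov2011, §4, proof of Prop. 4.1] -/
theorem mem_z2QuadConfig_of_sideChain {z₀ z₂ : ℂ} (hz₀ : z₀ ∈ Q.side 0) (hz₀O : z₀ ∈ openEdgeUnion δ η) (hz₂ : z₂ ∈ Q.side 2)
    (h : 𝔉.RevPt Q δ η z₀ z₂ ∨ ∃ s t, 𝔉.StartAt d₀ Q δ η z₀ s ∧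
      ReflTransGen (fun a b => 𝔉.Gst d₀ Q δ η a b ∨ 𝔉.Bit d₀ η a b) s t ∧ 𝔉.EndAt d₀ Q δ η t z₂) :
    Q ∈ z2QuadConfig D δ η := by
  rw [mem_z2QuadConfig_iff_exists_isCrossing hδ]
  refine exists_isCrossing_of_chain hδ Q (O := 𝔉.O) (acc := 𝔉.accU) hacc hz₀ hz₀O hz₂ ?_
  have revStep : ∀ {p q}, 𝔉.RevPt Q δ η p q → ChainStep Q δ η 𝔉.accU 𝔉.O p q :=
    fun ⟨S, hS, hSc, hp, hq⟩ => Or.inl ⟨S, hS, hSc, hp, hq⟩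
  rcases h with h | ⟨s, t, ⟨hhubs, v₀, hv₀, hstart⟩, hchain, hend⟩
  · exact ReflTransGen.single (revStep h)
  · -- invariant along the side chain
    have key : ∀ t, ReflTransGen (fun a b => 𝔉.Gst d₀ Q δ η a b ∨ 𝔉.Bit d₀ η a b) s t →
        ∃ v ∈ (𝔉.𝒯 t.1).att ((𝔉.𝒯 t.1).outCell (d₀ t.1) t.2), (𝔉.𝒯 t.1).hubContact (d₀ t.1) t.2 ∧
          (meshPoint δ v ∈ openEdgeUnion δ (η \ 𝔉.accU) ∧ meshPoint δ v ∈ Q.carrier) ∧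
          ReflTransGen (ChainStep Q δ η 𝔉.accU 𝔉.O) z₀ (meshPoint δ v) := by
      intro t ht
      induction ht with
      | refl => exact ⟨v₀, hv₀, hhubs, hstart.mem_right, ReflTransGen.single (revStep hstart)⟩
      | @tail b c _ hst ih =>
        obtain ⟨v, hv, hhubb, hvpt, hchainv⟩ := ih
        rcases hst with ⟨-, hhubc, w, hw, w', hw', hrev⟩ | ⟨hbc, x, k, x', k', hdx, hdx', hpath⟩
        · have hbr := revPt_of_att hhubη hhubQ hhubb hv hw hvpt
          exact ⟨w', hw', hhubc, hrev.mem_right, (hchainv.tail (revStep hbr)).tail (revStep hrev)⟩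
        · -- a docking bit inside the loop of `b.1 = c.1`
          obtain ⟨j, nb⟩ := b
          obtain ⟨j', nc⟩ := c
          simp only at hbc hdx hdx' hpath hv hhubb ⊢
          subst hbc
          obtain ⟨hσ, hβ, hηx, hcpt⟩ := hdx
          obtain ⟨hσ', hβ', hηx', hcpt'⟩ := hdx'
          obtain ⟨hxO, hxW, hxQ, hAx⟩ := dock_facts hacc hσ hβ hηx
          obtain ⟨hx'O, hx'W, hx'Q, hAx'⟩ := dock_facts hacc hσ' hβ' hηx'
          have hxO' : x ∈ (𝔉.𝒯 j).O := by rw [𝔉.O_eq]; exact hxO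
          have hx'O' : x' ∈ (𝔉.𝒯 j).O := by rw [𝔉.O_eq]; exact hx'O
          obtain ⟨hout, -, -⟩ := (𝔉.𝒯 j).hubContact_of_docking (h₀ j) hxO' hβ hcpt
          obtain ⟨hout', hhubc, hx'att⟩ := (𝔉.𝒯 j).hubContact_of_docking (h₀ j) hx'O' hβ' hcpt'
          rw [hout] at hv
          obtain ⟨rfl, -⟩ := mem_att_σc_iff.1 hv
          have hmap : ∀ {u w : Site 2}, ReflTransGen (OpenStep (𝔉.𝒯 j).U η) u w → ReflTransGen (AccAdj η 𝔉.accU) u w := by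
            intro u w h
            induction h with
            | refl => exact ReflTransGen.refl
            | tail _ hs ih' =>
              have h' := accAdj_of_openStep hs
              exact ih'.tail ⟨h'.1, h'.2.1, 𝔉.mem_accU_of_mem h'.2.2⟩
          have hAxU : AccAdj η 𝔉.accU v (v + cornerUnit k) := ⟨hAx.1, hAx.2.1, 𝔉.mem_accU_of_mem hAx.2.2⟩
          have hAx'U : AccAdj η 𝔉.accU x' (x' + cornerUnit k') := ⟨hAx'.1, hAx'.2.1, 𝔉.mem_accU_of_mem hAx'.2.2⟩
          have hwalk : ReflTransGen (AccAdj η 𝔉.accU) v x' :=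
            ((ReflTransGen.single hAxU).trans (hmap hpath)).tail hAx'U.symm
          have hstep : ChainStep Q δ η 𝔉.accU 𝔉.O (meshPoint δ v) (meshPoint δ x') :=
            Or.inr ⟨v, x', hxO, hx'O, rfl, rfl, hwalk⟩
          haveI : Nonempty ι := ⟨j⟩
          exact ⟨x', hx'att, hhubc, ⟨meshPoint_mem_openEdgeUnion_of_hub hhubη hx'O hx'W, hx'Q⟩, hchainv.tail hstep⟩
    obtain ⟨v, hv, hhubt, hvpt, hchainv⟩ := key t hchain
    obtain ⟨-, w, hw, hrev⟩ := hend
    have hbr := revPt_of_att hhubη hhubQ hhubt hv hw hvpt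
    exact (hchainv.tail (revStep hbr)).tail (revStep hrev)

omit hhubQ in
/-- **(⇒) Completeness of the side chain of the family.** [cite: SchrammSmirnov2011, §4, proof of Prop. 4.1] -/
theorem sideChain_of_mem_z2QuadConfig (hQ : Q ∈ z2QuadConfig D δ η) :
    ∃ z₀ ∈ Q.side 0 ∩ openEdgeUnion δ η, ∃ z₂ ∈ Q.side 2,
      𝔉.RevPt Q δ η z₀ z₂ ∨ ∃ s t, 𝔉.StartAt d₀ Q δ η z₀ s ∧
        ReflTransGen (fun a b => 𝔉.Gst d₀ Q δ η a b ∨ 𝔉.Bit d₀ η a b) s t ∧ 𝔉.EndAt d₀ Q δ η t z₂ := by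
  have hJ := junction_mem_O (𝔉 := 𝔉) (η := η) hcons hX
  obtain ⟨z₀, hz₀, z₂, hz₂, hchain⟩ := (mem_z2QuadConfig_iff_chain hδ Q hJ h0 h2 hacc).1 hQ
  refine ⟨z₀, hz₀, z₂, hz₂, ?_⟩
  set R := fun a b => 𝔉.Gst d₀ Q δ η a b ∨ 𝔉.Bit d₀ η a b with hR
  -- the invariant
  let Inv : ℂ → Prop := fun p => 𝔉.RevPt Q δ η z₀ p ∨ ∃ s t, 𝔉.StartAt d₀ Q δ η z₀ s ∧ ReflTransGen R s t ∧
    (𝔉.𝒯 t.1).hubContact (d₀ t.1) t.2 ∧ ∃ v ∈ (𝔉.𝒯 t.1).att ((𝔉.𝒯 t.1).outCell (d₀ t.1) t.2), 𝔉.RevPt Q δ η (meshPoint δ v) p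
  -- the dock-chain invariant at a hub vertex `c`
  let J : Site 2 → Prop := fun c => ∃ s t, 𝔉.StartAt d₀ Q δ η z₀ s ∧ ReflTransGen R s t ∧
    (𝔉.𝒯 t.1).hubContact (d₀ t.1) t.2 ∧ (𝔉.𝒯 t.1).outCell (d₀ t.1) t.2 = σc c ∧ c ∈ 𝔉.O ∧
    meshPoint δ c ∈ openEdgeUnion δ (η \ 𝔉.accU) ∧ meshPoint δ c ∈ Q.carrier
  -- folding docking pieces
  have fold : ∀ c b, J c → ReflTransGen (fun x y => x ∈ 𝔉.O ∧ y ∈ 𝔉.O ∧ ∃ i, (𝔉.𝒯 i).DockPiece η x y) c b → J b := by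
    intro c b hJc hcb
    induction hcb with
    | refl => exact hJc
    | @tail c' c'' _ hpiece ih =>
      obtain ⟨s, t, hstart, hrtg, hhubt, houtt, hc'O, hc'pt, hc'Q⟩ := ih
      obtain ⟨-, hc''O, i, k, k', hσ, hβ, hηc, hσ', hβ', hηc', hpath⟩ := hpiece
      obtain ⟨-, hc'W, -, -⟩ := dock_facts hacc hσ hβ hηc
      obtain ⟨-, hc''W, hc''Q, -⟩ := dock_facts hacc hσ' hβ' hηc'
      obtain ⟨ic, -, hcpt, houtic, hhubic, hattic⟩ := exists_side_of_dock (h₀ i) hσ hβ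
      obtain ⟨j', -, hcpt', houtj', hhubj', hattj'⟩ := exists_side_of_dock (h₀ i) hσ' hβ'
      have hbit : 𝔉.Bit d₀ η (i, ic) (i, j') :=
        ⟨rfl, c', k, c'', k', ⟨hσ, hβ, hηc, hcpt⟩, ⟨hσ', hβ', hηc', hcpt'⟩, hpath⟩
      have hc'O' : c' ∈ (𝔉.𝒯 i).O := by rw [𝔉.O_eq]; exact hc'O
      have hgst : 𝔉.Gst d₀ Q δ η t (i, ic) := by
        refine ⟨hhubt, hhubic, c', ?_, c', hattic, RevPt.of_mem hc'pt hc'Q⟩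
        rw [houtt]; exact mem_att_σc_iff.2 ⟨rfl, by rw [𝔉.O_eq]; exact hc'O⟩
      haveI : Nonempty ι := ⟨i⟩
      exact ⟨s, (i, j'), hstart, (hrtg.tail (Or.inl hgst)).tail (Or.inr hbit), hhubj', houtj', hc''O,
        meshPoint_mem_openEdgeUnion_of_hub (δ := δ) hhubη hc''O hc''W, hc''Q⟩
  -- the main induction along the chain
  have main : ∀ q, ReflTransGen (ChainStep Q δ η 𝔉.accU 𝔉.O) z₀ q → Inv q := by
    intro q hq
    induction hq with
    | refl =>
      exact Or.inl (RevPt.of_mem (mem_openEdgeUnion_sdiff_of_side0 h0 hz₀.1 hz₀.2) (Q.side_subset_carrier 0 hz₀.1))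
    | @tail p q _ hstep ih =>
      rcases hstep with ⟨S, hS, hSc, hp, hq⟩ | ⟨a, b, haO, hbO, rfl, rfl, hab⟩
      · have hpq : 𝔉.RevPt Q δ η p q := ⟨S, hS, hSc, hp, hq⟩
        rcases ih with h | ⟨s, t, hstart, hrtg, hhubt, v, hv, hrev⟩
        · exact Or.inl (h.trans hpq)
        · exact Or.inr ⟨s, t, hstart, hrtg, hhubt, v, hv, hrev.trans hpq⟩
      · -- a docking walk: split it into pieces
        have hd := exists_dockChain_of_accAdj haO hbO hab
        rcases hd.cases_head with rfl | ⟨c, hfirst, hrest⟩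
        · exact ih
        · -- the first piece docks at `a`: establish `J a`
          obtain ⟨-, -, i, k, k', hσa, hβa, hηa, -⟩ := hfirst
          obtain ⟨-, haW, haQ, -⟩ := dock_facts hacc hσa hβa hηa
          haveI : Nonempty ι := ⟨i⟩
          have hapt := meshPoint_mem_openEdgeUnion_of_hub (δ := δ) hhubη haO haW
          obtain ⟨ia, -, -, houtia, hhubia, hattia⟩ := exists_side_of_dock (h₀ i) hσa hβa
          have hJa : J a := by
            rcases ih with h | ⟨s, t, hstart, hrtg, hhubt, v, hv, hrev⟩
            · exact ⟨(i, ia), (i, ia), ⟨hhubia, a, hattia, h⟩, ReflTransGen.refl, hhubia, houtia, haO, hapt, haQ⟩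
            · have hgst : 𝔉.Gst d₀ Q δ η t (i, ia) := ⟨hhubt, hhubia, v, hv, a, hattia, hrev⟩
              exact ⟨s, (i, ia), hstart, hrtg.tail (Or.inl hgst), hhubia, houtia, haO, hapt, haQ⟩
          obtain ⟨s, t, hstart, hrtg, hhubt, houtt, -, hbpt, hbQ⟩ := fold a b hJa hd
          refine Or.inr ⟨s, t, hstart, hrtg, hhubt, b, ?_, RevPt.of_mem hbpt hbQ⟩
          rw [houtt]; exact mem_att_σc_iff.2 ⟨rfl, by rw [𝔉.O_eq]; exact hbO⟩
  rcases main z₂ hchain with h | ⟨s, t, hstart, hrtg, hhubt, v, hv, hrev⟩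
  · exact Or.inl h
  · exact Or.inr ⟨s, t, hstart, hrtg, ⟨hhubt, v, hv, hrev⟩⟩

/-- **The crossing event of the cut quad at the resolution of the sides of all the traced loops.**
For a family of tile domains (one per accessible component) sharing the explored data, the quad is
crossed iff a point of `∂₀Q` on a drawn open edge is joined to `∂₂Q` by a revealed connection, or
through a chain of loop sides linked alternately by revealed steps (between any two loops) and
docking bits (inside one loop).
[cite: SchrammSmirnov2011, §4, proof of Prop. 4.1 ("ω̃ ∈ ⊞_{Q₀} iff there is a path from ∂₀Q₀ to ∂₂Q₀ in G ∪ G*")] -/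
theorem mem_z2QuadConfig_iff_sideChain :
    Q ∈ z2QuadConfig D δ η ↔ ∃ z₀ ∈ Q.side 0 ∩ openEdgeUnion δ η, ∃ z₂ ∈ Q.side 2,
      𝔉.RevPt Q δ η z₀ z₂ ∨ ∃ s t, 𝔉.StartAt d₀ Q δ η z₀ s ∧
        ReflTransGen (fun a b => 𝔉.Gst d₀ Q δ η a b ∨ 𝔉.Bit d₀ η a b) s t ∧ 𝔉.EndAt d₀ Q δ η t z₂ :=
  ⟨sideChain_of_mem_z2QuadConfig h₀ hδ hcons hX hhubη h0 h2 hacc,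
    fun ⟨_, hz₀, _, hz₂, h⟩ => mem_z2QuadConfig_of_sideChain h₀ hδ hhubη hhubQ hacc hz₀.1 hz₀.2 hz₂ h⟩

end SideChain

/-! ### Contracting the ports of each loop -/

section Ports

variable {D : Set ℂ} {δ : ℝ} {Q : Quad D} {η : BondConfig (Site 2)} {d₀ : ι → Site 2 × Fin 4}

/-- **Examined open paths are revealed connections** (family version). [cite: SchrammSmirnov2011, §4, proof of Prop. 4.1 (the graph G)] -/
theorem revPt_of_hubConn (hhubη : ∀ e ∈ 𝔉.hubE, e ∈ η)
    (hhubQ : ∀ (y : Site 2) (m : Fin 4), dartEdge y m ∈ 𝔉.hubE →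
      segment ℝ (meshPoint δ y) (meshPoint δ (y + cornerUnit m)) ⊆ Q.carrier)
    {i : ι} {v w : Site 2} (h : (𝔉.𝒯 i).HubConn v w)
    (hv : meshPoint δ v ∈ openEdgeUnion δ (η \ 𝔉.accU) ∧ meshPoint δ v ∈ Q.carrier) :
    𝔉.RevPt Q δ η (meshPoint δ v) (meshPoint δ w) := by
  induction h with
  | refl => exact RevPt.of_mem hv.1 hv.2
  | @tail a b _ hab ih =>
    have hab' : s(a, b) ∈ 𝔉.hubE := by rw [← 𝔉.hubE_eq i]; exact hab
    have hE : s(a, b) ∈ (zdGraph 2).edgeSet := (𝔉.𝒯 i).hub_edge _ hab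
    obtain ⟨m, hm⟩ := exists_eq_dartEdge_of_mem hE (Sym2.mem_mk_left a b)
    have hb : b = a + cornerUnit m := by
      have : b ∈ dartEdge a m := hm ▸ Sym2.mem_mk_right a b
      rcases mem_dartEdge_iff.1 this with h | h
      · exact absurd h.symm ((SimpleGraph.mem_edgeSet (G := zdGraph 2)).1 hE).ne
      · exact h
    subst hb
    rw [hm] at hab'
    set S : Set ℂ := segment ℝ (meshPoint δ a) (meshPoint δ (a + cornerUnit m)) with hS
    have hSsub : S ⊆ openEdgeUnion δ (η \ 𝔉.accU) ∩ Q.carrier := by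
      refine subset_inter (fun z hz => ?_) (hhubQ a m hab')
      rw [mem_openEdgeUnion_iff]
      refine ⟨a, a + cornerUnit m, adj_iff_exists_cornerUnit.2 ⟨m, rfl⟩, ⟨hhubη _ hab', fun h => ?_⟩, hz⟩
      obtain ⟨j, hj⟩ := 𝔉.mem_accU_iff.1 h
      exact (𝔉.𝒯 j).acc_not_hub _ hj (by rw [𝔉.hubE_eq]; exact hab')
    exact ih.trans ⟨S, hSsub, (convex_segment _ _).isPreconnected, left_mem_segment _ _ _, right_mem_segment _ _ _⟩

variable (h₀ : ∀ i, IsBd (𝔉.𝒯 i).U (d₀ i)) (hT : ∀ i, (𝔉.𝒯 i).Terminal)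
  (hfar : ∀ i, ∀ c c' u₁ u₂ : Site 2, c ∈ (𝔉.𝒯 i).O → c' ∈ (𝔉.𝒯 i).O → (∃ f, TouchesFace c f ∧ TouchesFace c' f) →
    u₁ ∉ (𝔉.𝒯 i).Wv → u₂ ∉ (𝔉.𝒯 i).Wv → ReflTransGen (fun a b => s(a, b) ∈ (𝔉.𝒯 i).hubE) c u₁ →
    ReflTransGen (fun a b => s(a, b) ∈ (𝔉.𝒯 i).hubE) c' u₂ → ReflTransGen (FarAdj (𝔉.𝒯 i)) u₂ u₁)
  (hhubη : ∀ e ∈ 𝔉.hubE, e ∈ η)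
  (hhubQ : ∀ (y : Site 2) (m : Fin 4), dartEdge y m ∈ 𝔉.hubE →
    segment ℝ (meshPoint δ y) (meshPoint δ (y + cornerUnit m)) ⊆ Q.carrier)
include h₀ hT hfar hhubη hhubQ

/-- **Hub contacts of one port are revealed-connected** (family version of `gst_of_samePort`).
[cite: SchrammSmirnov2011, §4, proof of Prop. 4.1 (one vertex of G per open bay)] -/
theorem gst_of_samePort {i : ι} {a b : ℕ} (ha : (𝔉.𝒯 i).hubContact (d₀ i) a) (hb : (𝔉.𝒯 i).hubContact (d₀ i) b)
    (hab : (𝔉.𝒯 i).SamePort (d₀ i) (h₀ i) a b) : 𝔉.Gst d₀ Q δ η (i, a) (i, b) := by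
  obtain ⟨p, q, lo, hi', h1, h2, h3, h4, hopen⟩ := hab
  have hper : ∀ n r, (𝔉.𝒯 i).outCell (d₀ i) (n + r * period (h₀ i)) = (𝔉.𝒯 i).outCell (d₀ i) n :=
    outCell_add_mul_period (h₀ i)
  have ha' : (𝔉.𝒯 i).hubContact (d₀ i) (a + p * period (h₀ i)) := by rwa [TileData.hubContact, hper]
  have hb' : (𝔉.𝒯 i).hubContact (d₀ i) (b + q * period (h₀ i)) := by rwa [TileData.hubContact, hper]
  obtain ⟨v, hv⟩ := (𝔉.𝒯 i).att_nonempty ha'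
  obtain ⟨w, hw⟩ := (𝔉.𝒯 i).att_nonempty hb'
  have hconn : (𝔉.𝒯 i).HubConn v w := by
    rcases le_total (a + p * period (h₀ i)) (b + q * period (h₀ i)) with hle | hle
    · exact hubConn_of_open_stretch' (h₀ i) (hT i) (hfar i) hle (fun l hl1 hl2 => hopen l (by omega) (by omega)) ha' hb' hv hw
    · exact (hubConn_of_open_stretch' (h₀ i) (hT i) (hfar i) hle (fun l hl1 hl2 => hopen l (by omega) (by omega)) hb' ha' hw hv).symm
  have hvW : v ∈ 𝔉.Wv := by rw [← 𝔉.Wv_eq i]; exact att_mem_Wv (hT i) (h₀ i) ha' hv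
  have hvO : v ∈ 𝔉.O := by rw [← 𝔉.O_eq i]; exact hv.1
  haveI : Nonempty ι := ⟨i⟩
  have hhubQ' : ∀ (y : Site 2) (m : Fin 4), dartEdge y m ∈ (𝔉.𝒯 i).hubE →
      segment ℝ (meshPoint δ y) (meshPoint δ (y + cornerUnit m)) ⊆ Q.carrier := by
    rw [𝔉.hubE_eq]; exact hhubQ
  have hvpt : meshPoint δ v ∈ openEdgeUnion δ (η \ 𝔉.accU) ∧ meshPoint δ v ∈ Q.carrier :=
    ⟨meshPoint_mem_openEdgeUnion_of_hub hhubη hvO hvW, meshPoint_mem_carrier_of_hub hhubQ' hv.1 (by rw [𝔉.Wv_eq]; exact hvW)⟩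
  refine ⟨ha, hb, v, ?_, w, ?_, revPt_of_hubConn hhubη hhubQ hconn hvpt⟩
  · show v ∈ (𝔉.𝒯 i).att ((𝔉.𝒯 i).outCell (d₀ i) a)
    rwa [hper] at hv
  · show w ∈ (𝔉.𝒯 i).att ((𝔉.𝒯 i).outCell (d₀ i) b)
    rwa [hper] at hw

variable (𝔉 d₀) in
omit hT hfar hhubη hhubQ in
/-- **Port-level bits of the family**: inside one loop, between hub contacts of DIFFERENT ports.
[cite: SchrammSmirnov2011, §4, proof of Prop. 4.1 (edges of G*)] -/
def PortBit (η : BondConfig (Site 2)) (s t : Side ι) : Prop :=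
  s.1 = t.1 ∧ (𝔉.𝒯 s.1).PortBit (d₀ s.1) (h₀ s.1) η s.2 t.2

variable (hδ : 0 < δ) (hcons : ∀ e ∈ 𝔉.clE, e ∉ η)
  (hX : ∀ e ∈ (zdGraph 2).edgeSet, (∃ v ∈ e, v ∈ 𝔉.Wv) → (∃ u ∈ e, u ∉ 𝔉.Wv) → e ∈ 𝔉.hubE ∨ e ∈ 𝔉.clE)
  (hside0 : Disjoint (Q.side 0) (openEdgeUnion δ (η ∩ 𝔉.accU))) (hside2 : Disjoint (Q.side 2) (openEdgeUnion δ (η ∩ 𝔉.accU)))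
  (hacc : ∀ u v : Site 2, AccAdj η 𝔉.accU u v → segment ℝ (meshPoint δ u) (meshPoint δ v) ⊆ Q.carrier)
include hδ hcons hX hside0 hside2 hacc

/-- **The crossing event of the cut quad as a function of the explored data and the port-level bits
of all the accessible components.**
[cite: SchrammSmirnov2011, §4, proof of Prop. 4.1 ("ω̃ ∈ ⊞_{Q₀} iff there is a path from ∂₀Q₀ to ∂₂Q₀ in G ∪ G*")] -/
theorem mem_z2QuadConfig_iff_portChain :
    Q ∈ z2QuadConfig D δ η ↔ ∃ z₀ ∈ Q.side 0 ∩ openEdgeUnion δ η, ∃ z₂ ∈ Q.side 2,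
      𝔉.RevPt Q δ η z₀ z₂ ∨ ∃ s t, 𝔉.StartAt d₀ Q δ η z₀ s ∧
        ReflTransGen (fun a b => 𝔉.Gst d₀ Q δ η a b ∨ 𝔉.PortBit d₀ h₀ η a b) s t ∧ 𝔉.EndAt d₀ Q δ η t z₂ := by
  rw [mem_z2QuadConfig_iff_sideChain h₀ hδ hcons hX hhubη hhubQ hside0 hside2 hacc]
  have bitHub : ∀ {i : ι} {a b : ℕ}, (𝔉.𝒯 i).Bit (d₀ i) η a b →
      (𝔉.𝒯 i).hubContact (d₀ i) a ∧ (𝔉.𝒯 i).hubContact (d₀ i) b := by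
    rintro i a b ⟨x, k, x', k', ⟨hσ, hβ, -, hcpt⟩, ⟨hσ', hβ', -, hcpt'⟩, -⟩
    exact ⟨((𝔉.𝒯 i).hubContact_of_docking (h₀ i) (mem_O_of_dock hσ hβ) hβ hcpt).2.1,
      ((𝔉.𝒯 i).hubContact_of_docking (h₀ i) (mem_O_of_dock hσ' hβ') hβ' hcpt').2.1⟩
  have fwd : ∀ {s t : Side ι}, (𝔉.Gst d₀ Q δ η s t ∨ 𝔉.Bit d₀ η s t) →
      ReflTransGen (fun a b => 𝔉.Gst d₀ Q δ η a b ∨ 𝔉.PortBit d₀ h₀ η a b) s t := by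
    rintro ⟨i, a⟩ ⟨j, b⟩ (h | ⟨hij, h⟩)
    · exact ReflTransGen.single (Or.inl h)
    · simp only at hij h
      subst hij
      obtain ⟨ha, hb⟩ := bitHub h
      by_cases hsame : (𝔉.𝒯 i).SamePort (d₀ i) (h₀ i) a b
      · exact ReflTransGen.single (Or.inl (gst_of_samePort h₀ hT hfar hhubη hhubQ ha hb hsame))
      · exact ReflTransGen.single (Or.inr ⟨rfl, ha, hb, hsame, a, b, samePort_refl (h₀ i) ha, samePort_refl (h₀ i) hb, h⟩)
  have bwd : ∀ {s t : Side ι}, (𝔉.Gst d₀ Q δ η s t ∨ 𝔉.PortBit d₀ h₀ η s t) →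
      ReflTransGen (fun a b => 𝔉.Gst d₀ Q δ η a b ∨ 𝔉.Bit d₀ η a b) s t := by
    rintro ⟨i, a⟩ ⟨j, b⟩ (h | ⟨hij, h⟩)
    · exact ReflTransGen.single (Or.inl h)
    · simp only at hij h
      subst hij
      obtain ⟨ha, hb, -, a', b', haa', hbb', hbit⟩ := h
      obtain ⟨ha', hb'⟩ := bitHub hbit
      have s1 : ReflTransGen (fun a b => 𝔉.Gst d₀ Q δ η a b ∨ 𝔉.Bit d₀ η a b) (i, a) (i, a') :=
        ReflTransGen.single (Or.inl (gst_of_samePort h₀ hT hfar hhubη hhubQ ha ha' haa'))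
      have s2 : ReflTransGen (fun a b => 𝔉.Gst d₀ Q δ η a b ∨ 𝔉.Bit d₀ η a b) (i, a) (i, b') :=
        s1.tail (Or.inr ⟨rfl, hbit⟩)
      exact s2.tail (Or.inl (gst_of_samePort h₀ hT hfar hhubη hhubQ hb' hb hbb'.symm))
  have lift : ∀ {r r' : Side ι → Side ι → Prop}, (∀ {a b}, r a b → ReflTransGen r' a b) →
      ∀ {a b}, ReflTransGen r a b → ReflTransGen r' a b := by
    intro r r' h a b hab
    induction hab with
    | refl => exact ReflTransGen.refl
    | tail _ hs ih => exact ih.trans (h hs)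
  constructor
  · rintro ⟨z₀, hz₀, z₂, hz₂, h⟩
    refine ⟨z₀, hz₀, z₂, hz₂, h.imp id ?_⟩
    rintro ⟨s, t, hs, hc, he⟩
    exact ⟨s, t, hs, lift fwd hc, he⟩
  · rintro ⟨z₀, hz₀, z₂, hz₂, h⟩
    refine ⟨z₀, hz₀, z₂, hz₂, h.imp id ?_⟩
    rintro ⟨s, t, hs, hc, he⟩
    exact ⟨s, t, hs, lift bwd hc, he⟩

end Ports

end TileFamily

end CellComplex

end Literature.Probability.Percolation

end
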